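import Mathlib.Analysis.Normed.Module.FiniteDimension
import Mathlib.Analysis.SpecificLimits.Basic
import Mathlib.Topology.Sequences

/-!
# Crux `SymmetricScarExists` (stmt-NavierStokesRegularity-11718), line `rdss-screw-split` — stub
# `stub_closedSubgroupPlane_line` (AUX-8): a closed subgroup of the plane, non-discrete at `0`, contains a line

Helper file of the line lead (`--supports stmt-NavierStokesRegularity-11718`; theorems only, no definitions,
no named facts), pure topology/algebra of a proper real normed space (in particular the plane `ℝ × ℝ` with
its sup norm).  The lead applies it to the scar stabiliser of an apex profile in logarithmic screw
coordinates `(log c, θ)`, a closed additive subgroup of `ℝ × ℝ` (AUX-7).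

Statement: a closed additive subgroup `S` of a proper real normed space `E` containing nonzero elements of
arbitrarily small norm contains a whole line `{t • v | t ∈ ℝ}` with `v ≠ 0`
(`closedAddSubgroup_exists_line_of_properSpace`; the registered `ℝ × ℝ` instance is
`stub_closedSubgroupPlane_line`).

Proof: pick `s k ∈ S`, `s k ≠ 0`, `‖s k‖ < 1/(k+1)`; the unit directions `‖s k‖⁻¹ • s k` lie on the unit
sphere, compact in a proper space, so a subsequence converges to some `v` with `‖v‖ = 1`.  For `t : ℝ` the
integer multiples `⌊t / ‖s (φ k)‖⌋ • s (φ k) ∈ S` equal `(⌊t / r_k⌋ r_k) • (r_k⁻¹ • s (φ k))` with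
`r_k = ‖s (φ k)‖ → 0`, and `t - r_k ≤ ⌊t / r_k⌋ r_k ≤ t`, so they converge to `t • v`; `S` is closed, hence
`t • v ∈ S`.

## References

* N. Bourbaki, *General Topology*, Ch. VII §1.2, Prop. 3 (closed subgroups of `ℝⁿ`). [folklore]
-/

noncomputable section

open Set Function Filter Topology TopologicalSpace Metric
open scoped NNReal ENNReal

namespace Summit.NavierStokesRegularity.NavierStokesRegularity.Theorems.SymmetricScarExists.RdssSplit.ScarLevel
set_option linter.dupNamespace false

/-- **A closed additive subgroup of a proper real normed space in which `0` is not isolated contains a line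
through `0`.**  If `S ≤ E` is closed and contains nonzero elements of arbitrarily small norm, then there is
`v ≠ 0` with `t • v ∈ S` for every real `t` (directions of short nonzero elements subconverge on the compact
unit sphere; integer multiples of the short elements approximate every point of the limit line; closedness).
[folklore] -/
theorem closedAddSubgroup_exists_line_of_properSpace {E : Type*} [NormedAddCommGroup E]
    [NormedSpace ℝ E] [ProperSpace E] (S : AddSubgroup E) (hS : IsClosed (S : Set E))
    (hsmall : ∀ ε : ℝ, 0 < ε → ∃ s : E, s ∈ S ∧ s ≠ 0 ∧ ‖s‖ < ε) :
    ∃ v : E, v ≠ 0 ∧ ∀ t : ℝ, t • v ∈ S := by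
  -- short nonzero elements of `S`
  choose s hsS hs0 hsn using fun k : ℕ => hsmall (1 / ((k : ℝ) + 1)) Nat.one_div_pos_of_nat
  have hpos : ∀ k, 0 < ‖s k‖ := fun k => norm_pos_iff.2 (hs0 k)
  -- their unit directions lie on the (compact) unit sphere
  have hw : ∀ k, ‖s k‖⁻¹ • s k ∈ Metric.sphere (0 : E) 1 := fun k => by
    rw [mem_sphere_zero_iff_norm, norm_smul, norm_inv, norm_norm, inv_mul_cancel₀ (hpos k).ne']
  obtain ⟨v, hv, φ, hφ, hlim⟩ := (isCompact_sphere (0 : E) 1).tendsto_subseq hw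
  have hv1 : ‖v‖ = 1 := mem_sphere_zero_iff_norm.1 hv
  refine ⟨v, fun h => ?_, fun t => ?_⟩
  · rw [h, norm_zero] at hv1
    exact zero_ne_one hv1
  -- the radii along the subsequence tend to `0`
  have hr0 : Tendsto (fun k => ‖s (φ k)‖) atTop (𝓝 0) := by
    refine squeeze_zero (fun k => norm_nonneg _) (fun k => ?_)
      (tendsto_one_div_add_atTop_nhds_zero_nat (𝕜 := ℝ))
    have hk : (k : ℝ) ≤ (φ k : ℝ) := by exact_mod_cast hφ.le_apply
    calc ‖s (φ k)‖ ≤ 1 / ((φ k : ℝ) + 1) := (hsn (φ k)).le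
      _ ≤ 1 / ((k : ℝ) + 1) := one_div_le_one_div_of_le (Nat.cast_add_one_pos k) (by linarith)
  -- the real coefficients `⌊t / r_k⌋ * r_k` tend to `t`
  have hcoef : Tendsto (fun k => (⌊t / ‖s (φ k)‖⌋ : ℝ) * ‖s (φ k)‖) atTop (𝓝 t) := by
    have hle : ∀ k, (⌊t / ‖s (φ k)‖⌋ : ℝ) * ‖s (φ k)‖ ≤ t := fun k => by
      calc (⌊t / ‖s (φ k)‖⌋ : ℝ) * ‖s (φ k)‖ ≤ (t / ‖s (φ k)‖) * ‖s (φ k)‖ :=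
            mul_le_mul_of_nonneg_right (Int.floor_le _) (norm_nonneg _)
        _ = t := div_mul_cancel₀ t (hpos (φ k)).ne'
    have hge : ∀ k, t - ‖s (φ k)‖ ≤ (⌊t / ‖s (φ k)‖⌋ : ℝ) * ‖s (φ k)‖ := fun k => by
      have h := mul_lt_mul_of_pos_right (Int.lt_floor_add_one (t / ‖s (φ k)‖)) (hpos (φ k))
      rw [div_mul_cancel₀ t (hpos (φ k)).ne', add_mul, one_mul] at h
      linarith
    refine tendsto_of_tendsto_of_tendsto_of_le_of_le ?_ tendsto_const_nhds hge hle
    simpa only [sub_zero] using (tendsto_const_nhds (x := t)).sub hr0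
  -- the integer multiples `⌊t / r_k⌋ • s (φ k) ∈ S` converge to `t • v`
  have hmem : ∀ k, ((⌊t / ‖s (φ k)‖⌋ : ℝ) * ‖s (φ k)‖) • (‖s (φ k)‖⁻¹ • s (φ k)) ∈ S := fun k => by
    rw [smul_smul, mul_assoc, mul_inv_cancel₀ (hpos (φ k)).ne', mul_one, Int.cast_smul_eq_zsmul]
    exact S.zsmul_mem (hsS (φ k)) _
  have htend : Tendsto (fun k => ((⌊t / ‖s (φ k)‖⌋ : ℝ) * ‖s (φ k)‖) • (‖s (φ k)‖⁻¹ • s (φ k)))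
      atTop (𝓝 (t • v)) :=
    hcoef.smul hlim
  exact hS.mem_of_tendsto htend (Eventually.of_forall hmem)

/-- AUX-8 `stub_closedSubgroupPlane_line` — **a closed additive subgroup of the plane in which `0` is not
isolated contains a line through `0`**: if `S ≤ ℝ × ℝ` is closed and contains nonzero elements of
arbitrarily small (sup) norm, then `t • v ∈ S` for all real `t`, for some `v ≠ 0` (the plane is a proper
space; `closedAddSubgroup_exists_line_of_properSpace`). [folklore] -/
theorem stub_closedSubgroupPlane_line :
    ∀ S : AddSubgroup (ℝ × ℝ), IsClosed (S : Set (ℝ × ℝ)) → (∀ ε : ℝ, 0 < ε → ∃ s : ℝ × ℝ, s ∈ S ∧ s ≠ 0 ∧ ‖s‖ < ε) → ∃ v : ℝ × ℝ, v ≠ 0 ∧ ∀ t : ℝ, t • v ∈ S :=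
  fun S hS hsmall => closedAddSubgroup_exists_line_of_properSpace S hS hsmall

end Summit.NavierStokesRegularity.NavierStokesRegularity.Theorems.SymmetricScarExists.RdssSplit.ScarLevel
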